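import Mathlib
import HarnessLib

/-!
# WeilTypeLadder · compact orderings: the coset lift (every abelian group, every `N`)

b2b cell `hweil` (packet `run/shared/lean/b2b/hodge-weil/`, report `b2b-hweil-pv3-g41/NORM-RESIDUE.md` §5, prover 3 generation 41).
PURE COMBINATORICS in an additive commutative group, no geometry, no named fact, no `decide` over data; sibling of
`Theorems/WeilTypeLadderCombPieces` (`compactOrdering_exists_four`, `N = 4`) and `Theorems/WeilTypeLadderCyclicSexticOrderings`
(`ℤ/6`, all `N`).

A COMPACT ORDERING of a list of letters `β₁, …, β_N` (rotation numbers of a cyclic cover of `ℙ¹`, `Σ βᵢ = 0`) is an ordering all of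
whose PROPER prefix sums `s_k = β₁ + ⋯ + β_k` (`1 ≤ k ≤ N - 1`) are non-zero — the hypothesis of the packet's THEOREM DISC-PIECES
(comb degeneration). The referee's GP3g40-1 asks for compact-ordering witnesses beyond `N = 4`. This file proves the structural
lemma behind every witness the cell uses for `N ≥ 5` (the COSET LIFT): fix a subgroup `H`; if the first and the last letter lie
OUTSIDE `H` and the sub-list of letters outside `H` has all its proper prefix sums outside `H`, then EVERY proper prefix sum of the
whole list lies outside `H` — in particular is non-zero — wherever the letters of `H` are placed in between
(`prefixSum_not_mem_of_cosetLift`, `compactOrdering_of_cosetLift`). Reason: a prefix sum is congruent mod `H` to the sum of the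
outside letters it contains, and that is a proper, non-empty prefix sum of the outside sub-list. The case of exactly two outside
letters needs no hypothesis on the sub-list (`compactOrdering_two_outside`: `a :: (ins ++ [b])` with `a, b ∉ H`, `ins ⊂ H`), and
with `H = m'ℤ/mℤ` it reduces compact orderings in `ℤ/m` to compact orderings of the image in `ℤ/m'` (used with `m' ∈ {2, 3, 4}` for
the `ℤ/8`, `ℤ/12` scans of the packet).

HONEST LABEL: bookkeeping; 0 rungs; nothing of Markman 2025 / Mostaed 2026 / Perry 2026 is used.
-/

-- every declaration of this problem lives in `Summit.HodgeConjecture.HodgeConjecture.…` (summit = sub-problem)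
set_option linter.dupNamespace false

namespace Summit.HodgeConjecture.HodgeConjecture.WeilTypeLadder

section CompactOrderingCosetLift

variable {G : Type*} [AddCommGroup G] (H : AddSubgroup G) [DecidablePred (· ∈ H)]

/-- A list sum is congruent modulo the subgroup `H` to the sum of its letters outside `H`. [folklore] -/
theorem sum_sub_sum_filter_not_mem_mem (l : List G) :
    l.sum - (l.filter (fun x => decide (x ∉ H))).sum ∈ H := by
  induction l with
  | nil => simp
  | cons a l ih =>
    by_cases ha : a ∈ H
    · have e : (a :: l).filter (fun x => decide (x ∉ H)) = l.filter (fun x => decide (x ∉ H)) := by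
        simp [ha]
      rw [e, List.sum_cons, add_sub_assoc]
      exact H.add_mem ha ih
    · have e : (a :: l).filter (fun x => decide (x ∉ H)) = a :: l.filter (fun x => decide (x ∉ H)) := by
        simp [ha]
      rw [e, List.sum_cons, List.sum_cons, add_sub_add_left_eq_sub]
      exact ih

/-- Membership in `H` of a list sum only depends on the sum of the letters outside `H`. [folklore] -/
theorem sum_mem_iff_sum_filter_not_mem_mem (l : List G) :
    l.sum ∈ H ↔ (l.filter (fun x => decide (x ∉ H))).sum ∈ H := by
  have h := sum_sub_sum_filter_not_mem_mem H l
  constructor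
  · intro hs
    have := H.sub_mem hs h
    simpa using this
  · intro hf
    have := H.add_mem h hf
    simpa using this

omit [AddCommGroup G] in
/-- The outside letters of a prefix form a prefix of the outside letters. [folklore] -/
theorem filter_take_eq_take_filter (p : G → Bool) (l : List G) (k : ℕ) :
    (l.take k).filter p = (l.filter p).take ((l.take k).filter p).length := by
  have hpre : (l.take k).filter p <+: l.filter p := (List.take_prefix k l).filter p
  exact List.prefix_iff_eq_take.mp hpre

/-- **THE COSET LIFT (prefix sums outside a subgroup).** Let `H` be a subgroup, `l` a list whose FIRST and LAST letters lie outside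
`H`, and let `out = l.filter (· ∉ H)` be its sub-list of letters outside `H`. If every proper non-empty prefix sum of `out`
(`(out.take i).sum`, `0 < i < out.length`) lies outside `H`, then every proper non-empty prefix sum of `l` lies outside `H`.
(The letters inside `H` may sit anywhere in between.) [folklore] -/
theorem prefixSum_not_mem_of_cosetLift (l : List G) (hne : l ≠ [])
    (hhead : l.head hne ∉ H) (hlast : l.getLast hne ∉ H)
    (hout : ∀ i, 0 < i → i < (l.filter (fun x => decide (x ∉ H))).length →
      ((l.filter (fun x => decide (x ∉ H))).take i).sum ∉ H) :
    ∀ k, 0 < k → k < l.length → (l.take k).sum ∉ H := by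
  intro k hk0 hk hmem
  set p : G → Bool := fun x => decide (x ∉ H) with hp
  set i := ((l.take k).filter p).length with hi
  have hfk : (l.take k).filter p = (l.filter p).take i := filter_take_eq_take_filter p l k
  -- the prefix sum is in `H` iff the corresponding prefix sum of the outside letters is
  have hmem' : ((l.filter p).take i).sum ∈ H := by
    rw [← hfk]
    exact (sum_mem_iff_sum_filter_not_mem_mem H (l.take k)).mp hmem
  -- `0 < i`: the head of `l` is an outside letter inside the prefix
  have hi0 : 0 < i := by
    obtain ⟨a, t, rfl⟩ := List.exists_cons_of_ne_nil hne
    simp only [List.head_cons] at hhead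
    obtain ⟨k', rfl⟩ : ∃ k', k = k' + 1 := ⟨k - 1, by omega⟩
    rw [hi, List.take_succ_cons, List.filter_cons]
    have : p a = true := by simp [hp, hhead]
    simp [this]
  -- `i < out.length`: the last letter of `l` is an outside letter beyond the prefix
  have hil : i < (l.filter p).length := by
    have hsplit : l.filter p = (l.take k).filter p ++ (l.drop k).filter p := by
      rw [← List.filter_append, List.take_append_drop]
    have hdrop_ne : l.drop k ≠ [] := by
      intro h
      have := List.drop_eq_nil_iff.mp h
      omega
    have hlast' : (l.drop k).getLast hdrop_ne ∉ H := by
      rwa [List.getLast_drop]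
    have hpos : 0 < ((l.drop k).filter p).length := by
      have hm : (l.drop k).getLast hdrop_ne ∈ (l.drop k).filter p := by
        rw [List.mem_filter]
        refine ⟨List.getLast_mem hdrop_ne, ?_⟩
        simp only [hp, decide_eq_true_eq]
        exact hlast'
      exact List.length_pos_of_mem hm
    rw [hsplit, List.length_append, ← hi]
    omega
  exact hout i hi0 hil hmem'

/-- **Compact ordering by the coset lift.** Under the hypotheses of `prefixSum_not_mem_of_cosetLift` every proper non-empty prefix
sum of `l` is NON-ZERO (as `0 ∈ H`): the list is compactly ordered. [folklore] -/
theorem compactOrdering_of_cosetLift (l : List G) (hne : l ≠ [])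
    (hhead : l.head hne ∉ H) (hlast : l.getLast hne ∉ H)
    (hout : ∀ i, 0 < i → i < (l.filter (fun x => decide (x ∉ H))).length →
      ((l.filter (fun x => decide (x ∉ H))).take i).sum ∉ H) :
    ∀ k, 0 < k → k < l.length → (l.take k).sum ≠ 0 := by
  intro k hk0 hk h0
  exact prefixSum_not_mem_of_cosetLift H l hne hhead hlast hout k hk0 hk (h0 ▸ H.zero_mem)

omit [DecidablePred (· ∈ H)] in
/-- **Two outside letters.** If `a ∉ H` and every letter of `ins` lies in `H`, the list `a :: (ins ++ [b])` has all its proper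
non-empty prefix sums outside `H` (they lie in the coset `a + H ≠ H`), hence non-zero: a compact ordering, for every placement of the
inside letters — no hypothesis on the last letter `b` is needed (in the application `b ∉ H` as well; N-P3g41-3). (With `H = 2ℤ/2kℤ ⊂ ℤ/2k`: a tuple with exactly two odd rotation numbers is compactly ordered by putting them first
and last.) [folklore] -/
theorem compactOrdering_two_outside (a b : G) (ins : List G) (ha : a ∉ H) (hins : ∀ x ∈ ins, x ∈ H) :
    ∀ k, 0 < k → k < (a :: (ins ++ [b])).length → ((a :: (ins ++ [b])).take k).sum ∉ H := by
  intro k hk0 hk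
  obtain ⟨k', rfl⟩ : ∃ k', k = k' + 1 := ⟨k - 1, by omega⟩
  simp only [List.length_cons, List.length_append, List.length_nil] at hk
  rw [List.take_succ_cons, List.sum_cons]
  have hk' : k' ≤ ins.length := by omega
  rw [List.take_append_of_le_length hk']
  have hH : (ins.take k').sum ∈ H :=
    H.list_sum_mem (fun x hx => hins x (List.mem_of_mem_take hx))
  intro hmem
  apply ha
  have := H.sub_mem hmem hH
  simpa using this

end CompactOrderingCosetLift

end Summit.HodgeConjecture.HodgeConjecture.WeilTypeLadder
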